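import Literature.AlgebraicGeometry.HodgeTheory.ClassesSupportedOnComplexification
import Mathlib.RingTheory.Flat.Equalizer
import Mathlib.LinearAlgebra.TensorProduct.Pi
import HarnessLib

/-!
# Crux `HodgeProjectorDivisorSupported` (stmt-HodgeConjecture-18704), line `birth` — stub D, part I:
# ℚ-DESCENT OF A LINEAR SYSTEM WITH RATIONAL COEFFICIENTS (linear algebra of `ℚ`-structures)

Route `HodgeConjecture/HodgeProjectorDivisorSupport`. Helper file for `stub_integralProjectorCycle`
(`HodgeProjectorDivisorSupportHodgeProjectorDivisorSupportedIntegralProjectorCycle.lean`), which feeds the lemma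
below with the `ℚ`-structures `Hᵏ(X(ℂ); ℚ) ⊗ ℂ = Hᵏ(X(ℂ); ℂ)` of a smooth projective variety.

§1 (`exists_int_combination`). Let `β : A ⊗_ℚ V₀ ≃ V`, `β' : A ⊗_ℚ W₀ ≃ W` be `ℚ`-structures over a field
`A ⊇ ℚ`, `Tᵢ = β (ψᵢ ⊗ 1) β⁻¹ : V → V` and finitely many `L_k = β' (ℓ_k ⊗ 1) β⁻¹ : V → W` maps defined over `ℚ`,
`S₀ ⊆ V₀`. If `Φ = Σ cᵢ Tᵢ` (`cᵢ ∈ A`) is the identity on the rational vectors `β (1 ⊗ a)`, `a ∈ S₀`, and kills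
the common kernel of the `L_k`, then for integers `mᵢ` and `N ≥ 1`, `Σ mᵢ Tᵢ` is `N •` the identity there and
kills the same kernel. Proof: a `ℚ`-linear retraction `r : A → ℚ` of `ℚ ⊆ A` (`exists_rat_retraction`) applied to
the coefficients preserves both conditions — the first by applying `r ⊗ 1 : A ⊗ V₀ → V₀`, the second because the
common kernel is the base change of `⋂ ker ℓ_k` (`A` is flat over `ℚ`: `Module.Flat.ker_lTensor_eq`; finite
products commute with `⊗`: `TensorProduct.piRight`) on which `Σ r(cᵢ) ψᵢ` vanishes — and denominators are cleared
(`exists_int_eq_nat_mul`). §2 (`exists_ratLinearMap_ofRatClass`): a `ℂ`-linear map of complex cohomology groups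
carrying rational classes to rational classes descends to the rational lattices (`ofRatClass` spelling of
`HodgeTheory.exists_ratLinearMap_of_isRationalClass`).

HONEST STATUS. Linear algebra only; no geometry, no definition, no named fact, no sorry.
References: [VoisinHodgeI2002] §7.1.1; [HatcherAT2002] §3.1 p. 198; folklore (`ℚ`-forms of linear systems).
-/

noncomputable section

set_option linter.dupNamespace false

open scoped TensorProduct
open Literature.AlgebraicGeometry.Motives Literature.AlgebraicGeometry.HodgeTheory
open Literature.AlgebraicTopology.SingularHomology

namespace Summit.HodgeConjecture.HodgeConjecture.Theorems.HodgeProjectorDivisorSupported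

/-! ## §1 Linear algebra of ℚ-structures: kernels, retractions, denominators -/

section Descent

variable {A : Type*} [Field A] [Algebra ℚ A]
  {V₀ W₀ : Type*} [AddCommGroup V₀] [Module ℚ V₀] [AddCommGroup W₀] [Module ℚ W₀]
  {V W : Type*} [AddCommGroup V] [Module A V] [AddCommGroup W] [Module A W]

variable (A) in
/-- A `ℚ`-linear retraction of the structure map `ℚ → A` of a field extension. [folklore] -/
theorem exists_rat_retraction : ∃ r : A →ₗ[ℚ] ℚ, ∀ q : ℚ, r (algebraMap ℚ A q) = q := by
  obtain ⟨r, hr⟩ := (Algebra.linearMap ℚ A).exists_leftInverse_of_injective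
    (LinearMap.ker_eq_bot.2 (algebraMap ℚ A).injective)
  exact ⟨r, fun q ↦ by simpa using LinearMap.congr_fun hr q⟩

/-- **Clearing denominators** in a finite family of rationals: `m i = N · q i ∈ ℤ` for one `N ≥ 1`.
[folklore] -/
theorem exists_int_eq_nat_mul {ι : Type*} (s : Finset ι) (q : ι → ℚ) :
    ∃ (N : ℕ) (m : ι → ℤ), N ≠ 0 ∧ ∀ i ∈ s, (m i : ℚ) = N * q i := by
  refine ⟨∏ j ∈ s, (q j).den, fun i ↦ (((∏ j ∈ s, (q j).den) / (q i).den : ℕ) : ℤ) * (q i).num,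
    Finset.prod_ne_zero_iff.2 fun j _ ↦ (q j).den_nz, fun i hi ↦ ?_⟩
  have hdvd : (q i).den ∣ ∏ j ∈ s, (q j).den := Finset.dvd_prod_of_mem _ hi
  have hden : ((q i).den : ℚ) ≠ 0 := Nat.cast_ne_zero.2 (q i).den_nz
  rw [Int.cast_mul, Int.cast_natCast, Nat.cast_div hdvd hden]
  conv_rhs => rw [← Rat.num_div_den (q i)]
  ring

/-- **Over a field, the kernel of a base change is the base change of the kernel** (`A` is flat
over `ℚ`). [folklore] -/
theorem ker_baseChange_eq (f : V₀ →ₗ[ℚ] W₀) :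
    LinearMap.ker (f.baseChange A) = (LinearMap.ker f).baseChange A :=
  Module.Flat.ker_lTensor_eq A A f

/-- A vector of `A ⊗ V₀` killed by the base changes of finitely many `ℚ`-linear maps lies in the
base change of the intersection of their kernels. [folklore] -/
theorem mem_baseChange_iInf_ker {κ : Type*} [Fintype κ] [DecidableEq κ]
    (ℓ : κ → (V₀ →ₗ[ℚ] W₀)) {t : A ⊗[ℚ] V₀} (ht : ∀ k, (ℓ k).baseChange A t = 0) :
    t ∈ (⨅ k, LinearMap.ker (ℓ k)).baseChange A := by
  rw [← LinearMap.ker_pi, ← ker_baseChange_eq, LinearMap.mem_ker]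
  have key : ∀ (u : A ⊗[ℚ] V₀) k, (ℓ k).baseChange A u =
      TensorProduct.piRight ℚ A A (fun _ : κ ↦ W₀) ((LinearMap.pi ℓ).baseChange A u) k := by
    intro u k
    induction u using TensorProduct.induction_on with
    | zero => simp
    | tmul x v => simp [TensorProduct.piRightHom_tmul]
    | add u u' h h' => simp only [map_add, Pi.add_apply, h, h']
  apply (TensorProduct.piRight ℚ A A (fun _ : κ ↦ W₀)).injective
  rw [map_zero]
  funext k
  rw [← key t k, ht k, Pi.zero_apply]

/-- **ℚ-descent of a linear system with rational coefficients.** Let `β : A ⊗_ℚ V₀ ≃ V`,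
`β' : A ⊗_ℚ W₀ ≃ W` be `A`-structures with `ℚ`-forms, `L k : V → W` (`k` in a finite type) `A`-linear
maps defined over `ℚ` (`L k ∘ β(1 ⊗ ·) = β'(1 ⊗ ℓ k ·)`), `T i : V → V` `A`-linear maps defined over
`ℚ` (`ψ i`), and `S₀ ⊆ V₀`. If a complex combination `Φ = Σ c i • T i` is the identity on the vectors
`β (1 ⊗ a)`, `a ∈ S₀`, and kills the common kernel of the `L k`, then an INTEGRAL combination
`Σ m i • T i` is `N •` the identity there (`N ≥ 1`) and kills the same kernel: apply a `ℚ`-linear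
retraction `A → ℚ` to the coefficients (the common kernel is spanned by rational vectors, `A` being
flat over `ℚ`) and clear denominators. [folklore] -/
theorem exists_int_combination (β : A ⊗[ℚ] V₀ ≃ₗ[A] V) (β' : A ⊗[ℚ] W₀ ≃ₗ[A] W)
    {κ : Type*} [Fintype κ] [DecidableEq κ]
    (L : κ → (V →ₗ[A] W)) (ℓ : κ → (V₀ →ₗ[ℚ] W₀))
    (hL : ∀ k v, L k (β (1 ⊗ₜ v)) = β' (1 ⊗ₜ ℓ k v))
    (S₀ : Set V₀) {ι : Type*} (s : Finset ι) (T : ι → (V →ₗ[A] V)) (ψ : ι → (V₀ →ₗ[ℚ] V₀))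
    (hT : ∀ i v, T i (β (1 ⊗ₜ v)) = β (1 ⊗ₜ ψ i v)) (c : ι → A)
    (hI : ∀ a ∈ S₀, (∑ i ∈ s, c i • T i) (β (1 ⊗ₜ a)) = β (1 ⊗ₜ a))
    (hII : ∀ b : V, (∀ k, L k b = 0) → (∑ i ∈ s, c i • T i) b = 0) :
    ∃ (N : ℕ) (m : ι → ℤ), N ≠ 0 ∧
      (∀ a ∈ S₀, (∑ i ∈ s, m i • T i) (β (1 ⊗ₜ a)) = N • β (1 ⊗ₜ a)) ∧
      (∀ b : V, (∀ k, L k b = 0) → (∑ i ∈ s, m i • T i) b = 0) := by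
  classical
  -- (0) `T i`, `L k` are the base changes of `ψ i`, `ℓ k`, transported by `β`, `β'`
  have htm : ∀ (x : A) (v : V₀), x ⊗ₜ[ℚ] v = x • ((1 : A) ⊗ₜ[ℚ] v) := fun x v ↦ by
    rw [TensorProduct.smul_tmul', smul_eq_mul, mul_one]
  have hTβ : ∀ i (t : A ⊗[ℚ] V₀), T i (β t) = β ((ψ i).baseChange A t) := by
    intro i t
    induction t using TensorProduct.induction_on with
    | zero => simp
    | tmul x v =>
      rw [LinearMap.baseChange_tmul, htm x v, htm x (ψ i v)]
      simp only [map_smul]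
      rw [hT]
    | add t t' h h' => rw [map_add, map_add, h, h', map_add, map_add]
  have hLβ : ∀ k (t : A ⊗[ℚ] V₀), L k (β t) = β' ((ℓ k).baseChange A t) := by
    intro k t
    induction t using TensorProduct.induction_on with
    | zero => simp
    | tmul x v =>
      rw [LinearMap.baseChange_tmul, htm x v, map_smul, map_smul, hL, ← map_smul,
        TensorProduct.smul_tmul', smul_eq_mul, mul_one]
    | add t t' h h' => rw [map_add, map_add, h, h', map_add, map_add]
  -- (1) a `ℚ`-linear retraction of `ℚ → A` and the induced `ρ : A ⊗ V₀ → V₀`, `x ⊗ v ↦ r(x) v`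
  obtain ⟨r, hr⟩ := exists_rat_retraction A
  let ρ : A ⊗[ℚ] V₀ →ₗ[ℚ] V₀ := (TensorProduct.lid ℚ V₀).toLinearMap ∘ₗ r.rTensor V₀
  have hρ : ∀ (x : A) (v : V₀), ρ (x ⊗ₜ v) = r x • v := fun x v ↦ by
    simp [ρ, LinearMap.rTensor_tmul]
  have hρ1 : ∀ v : V₀, ρ ((1 : A) ⊗ₜ v) = v := fun v ↦ by
    rw [hρ, show (1 : A) = algebraMap ℚ A 1 from (map_one _).symm, hr, one_smul]
  -- (2) the rational operator `ψ' := Σ r(c i) • ψ i`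
  set ψ' : V₀ →ₗ[ℚ] V₀ := ∑ i ∈ s, r (c i) • ψ i with hψ'
  have hρΦ : ∀ v : V₀, ρ (β.symm ((∑ i ∈ s, c i • T i) (β (1 ⊗ₜ v)))) = ψ' v := by
    intro v
    rw [LinearMap.sum_apply, map_sum, map_sum, hψ', LinearMap.sum_apply]
    refine Finset.sum_congr rfl fun i _ ↦ ?_
    rw [LinearMap.smul_apply, hTβ, LinearMap.baseChange_tmul, ← map_smul,
      LinearEquiv.symm_apply_apply, ← htm, hρ, LinearMap.smul_apply]
  have hI' : ∀ a ∈ S₀, ψ' a = a := fun a ha ↦ by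
    rw [← hρΦ, hI a ha, LinearEquiv.symm_apply_apply, hρ1]
  set K : Submodule ℚ V₀ := ⨅ k, LinearMap.ker (ℓ k) with hK
  have hII' : ∀ p ∈ K, ψ' p = 0 := fun p hp ↦ by
    have h0 : (∑ i ∈ s, c i • T i) (β (1 ⊗ₜ p)) = 0 := by
      refine hII _ fun k ↦ ?_
      rw [hL, show ℓ k p = 0 from LinearMap.mem_ker.1 ((Submodule.mem_iInf _).1 hp k),
        TensorProduct.tmul_zero, map_zero]
    rw [← hρΦ, h0, map_zero, map_zero]
  -- (3) clear denominators: `m i = N · r(c i)`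
  obtain ⟨N, m, hN, hm⟩ := exists_int_eq_nat_mul s fun i ↦ r (c i)
  set Ψ₀ : V₀ →ₗ[ℚ] V₀ := ∑ i ∈ s, m i • ψ i with hΨ₀
  have hΨ₀ψ' : ∀ v, Ψ₀ v = N • ψ' v := fun v ↦ by
    rw [hΨ₀, hψ', LinearMap.sum_apply, LinearMap.sum_apply, Finset.smul_sum]
    refine Finset.sum_congr rfl fun i hi ↦ ?_
    rw [LinearMap.smul_apply, LinearMap.smul_apply, ← Int.cast_smul_eq_zsmul ℚ, hm i hi, mul_smul,
      Nat.cast_smul_eq_nsmul]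
  -- (4) `Σ m i • T i = β ∘ (Ψ₀ ⊗ 1) ∘ β⁻¹`
  have hΨβ : ∀ t : A ⊗[ℚ] V₀, (∑ i ∈ s, m i • T i) (β t) = β (Ψ₀.baseChange A t) := by
    intro t
    induction t using TensorProduct.induction_on with
    | zero => simp
    | tmul x v =>
      rw [LinearMap.baseChange_tmul, hΨ₀, LinearMap.sum_apply, LinearMap.sum_apply,
        TensorProduct.tmul_sum, map_sum]
      refine Finset.sum_congr rfl fun i _ ↦ ?_
      rw [LinearMap.smul_apply, LinearMap.smul_apply, hTβ, LinearMap.baseChange_tmul, ← map_zsmul β,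
        TensorProduct.tmul_smul]
    | add t t' h h' => rw [map_add, map_add, h, h', map_add, map_add]
  -- (5) conclusions
  refine ⟨N, m, hN, fun a ha ↦ ?_, fun b hb ↦ ?_⟩
  · rw [hΨβ, LinearMap.baseChange_tmul, hΨ₀ψ', hI' a ha, TensorProduct.tmul_smul, map_nsmul]
  · set t := β.symm b with ht
    have hkt : ∀ k, (ℓ k).baseChange A t = 0 := fun k ↦ β'.injective (by
      rw [← hLβ, ht, LinearEquiv.apply_symm_apply, hb k, map_zero])
    obtain ⟨s', hs'⟩ := LinearMap.mem_range.1 (mem_baseChange_iInf_ker ℓ hkt)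
    have hzero : Ψ₀ ∘ₗ K.subtype = 0 := LinearMap.ext fun p ↦ by
      rw [LinearMap.comp_apply, Submodule.subtype_apply, hΨ₀ψ', hII' _ p.2, smul_zero,
        LinearMap.zero_apply]
    calc (∑ i ∈ s, m i • T i) b = (∑ i ∈ s, m i • T i) (β t) := by
          rw [ht, LinearEquiv.apply_symm_apply]
      _ = β (Ψ₀.baseChange A t) := hΨβ t
      _ = 0 := by
          rw [← hs', ← LinearMap.comp_apply (Ψ₀.baseChange A), ← LinearMap.baseChange_comp, hzero,
            LinearMap.baseChange_zero, LinearMap.zero_apply, map_zero]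

end Descent

/-! ## §2 A `ℂ`-linear map carrying rational classes to rational classes descends to the lattices -/

section RationalMaps

universe u

variable {Y Y' : Type u} [TopologicalSpace Y] [TopologicalSpace Y']

/-- **A `ℂ`-linear map `G : Hᵃ(Y; ℂ) → Hᵇ(Y'; ℂ)` carrying rational classes to rational classes is
defined over `ℚ`**: `G (a ⊗ 1) = (ψ a) ⊗ 1` for a (unique) `ℚ`-linear `ψ : Hᵃ(Y; ℚ) → Hᵇ(Y'; ℚ)`
(`ψ a` is the rational preimage of the rational class `G (a ⊗ 1)`; additivity and homogeneity by
injectivity of the lattice map). The `ofRatClass`-spelling of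
`HodgeTheory.exists_ratLinearMap_of_isRationalClass`. [cite: VoisinHodgeI2002, §7.1.1]
[cite: HatcherAT2002, §3.1 p. 198] -/
theorem exists_ratLinearMap_ofRatClass {a b : ℕ}
    (G : singularCohomology ℂ ℂ Y a →ₗ[ℂ] singularCohomology ℂ ℂ Y' b)
    (hG : ∀ y, IsRationalClass y → IsRationalClass (G y)) :
    ∃ ψ : singularCohomology ℚ ℚ Y a →ₗ[ℚ] singularCohomology ℚ ℚ Y' b,
      ∀ y, G (ofRatClass Y a y) = ofRatClass Y' b (ψ y) := by
  have key : ∀ y : singularCohomology ℚ ℚ Y a, ∃ x : singularCohomology ℚ ℚ Y' b,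
      ofRatClass Y' b x = G (ofRatClass Y a y) := fun y ↦
    (isRationalClass_iff_mem_range_ofRatClass _).1 (hG _ (isRationalClass_ofRatClass y))
  choose f hf using key
  refine ⟨{ toFun := f, map_add' := fun y y' ↦ ?_, map_smul' := fun q y ↦ ?_ }, fun y ↦ (hf y).symm⟩
  · apply ofRatClass_injective
    rw [map_add, hf, hf, hf, map_add, map_add]
  · apply ofRatClass_injective
    rw [RingHom.id_apply, ofRatClass_smul, hf, hf, ofRatClass_smul, map_smul]

end RationalMaps

end Summit.HodgeConjecture.HodgeConjecture.Theorems.HodgeProjectorDivisorSupported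

end
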